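import Summits.ABC.ABC.Theses.IneffectiveSubspace
import Summits.ABC.ABC.Theorems.IneffectiveSubspaceTowerFourGivesDepthCounted
import Summits.ABC.ABC.Theorems.IneffectiveSubspaceUniformSadicGivesTowerFour
import Summits.ABC.ABC.Theorems.IneffectiveSubspaceDepthCountedABCStubDictionary
import Summits.ABC.ABC.Theorems.IneffectiveSubspaceDepthCountedABCCertificatesDictionary

/-!
# Stub `stub_s4SmallMemberOfTowerFour` of line `Sketch` — crux `IneffectiveSubspace.DepthCountedABC` (stmt-ABC-14938)

THE PARENT CRUX AT `K = 0` GIVES THE SMALL-MEMBER STATEMENT: `UniformSadicTowerFour → S4SmallMemberABC`.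

* Hypothesis: the route's parent crux #2 `UniformSadicTowerFour` (Ridout at level four; route file
  `Summits/ABC/ABC/Theses/IneffectiveSubspace.lean`), used only at `K = 0`, `S = ∅`, where it is the
  level-4 tower inequality with exponent `1`: `∏ z_i^(i+1) < C · (∏ x_i y_i z_i)^(1+ε)` on positive
  coprime solutions of `∏ x_i^(i+1) + ∏ y_i^(i+1) = ∏ z_i^(i+1)` (`i < 4`).
* Conclusion (`S4SmallMemberABC`, unfolded): abc with the member `a` at FULL SIZE and `b, c` charged
  through the level-4 radical `S₄(n) := ∏_{p ∣ n} p^⌈v_p(n)/4⌉ = ∏ p ∈ n.primeFactors, p ^ ((v_p(n)+3)/4)`: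
  for every `ε > 0` some `C > 0` with `c ≤ C · a · (S₄(b)·S₄(c))^(1+ε)` on every abc triple.

Proof.  Given `ε`, apply the hypothesis with `K := 0`, `ε' := ε/5`, and output its constant `C`.
For an abc triple `(a, b, c)` take optimal level-4 lifts `x` of `a`, `y` of `b`, `z` of `c`
(`TowerFourGivesDepthCounted.exists_lift`: all entries `≥ 1`, `∏ x_i^(i+1) = a`, …,
`v_p(∏ x_i) = ⌈v_p(a)/4⌉`, …) and `S := ∅`.  The tower hypotheses are those of the triple, and with
`M := ∏ x_i y_i z_i` the `S = ∅` bracket is `M` itself, so `c < C · M^(1+ε/5)`.  Now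
`M = (∏ x_i)(∏ y_i)(∏ z_i) = S₄(a) S₄(b) S₄(c)` (`stubDictionary_prod_lift_eq`) and `S₄(a) ≤ a`
(`S₄(a) ∣ a`, as `⌈v/4⌉ ≤ v`), so `c < C · (a·S)^(1+ε/5)` with `S := S₄(b) S₄(c)`.  Finally
`(a S)^(1+ε/5) = a · a^(ε/5) · S^(1+ε/5)` and `a^(ε/5) ≤ c^(ε/5) ≤ S^(4ε/5)` because
`c ≤ S₄(c)⁴ ≤ S⁴` (`c ∣ S₄(c)⁴`, as `v ≤ 4⌈v/4⌉`); in total `c < C · a · S^(1+ε)`.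

Sources: skeleton `Cruxes/DepthCountedABC/Lines/Sketch.lean` of lead `prover-line-stmt-ABC-14938-0`
(stub `stub_s4SmallMemberOfTowerFour`).  The optimal lift is
`Summit.ABC.ABC.Theorems.TowerFourGivesDepthCounted.exists_lift` (Vojta 2000 §3.1 at level `4`, landed
in `Theorems/IneffectiveSubspaceTowerFourGivesDepthCounted.lean`); the identification of the lift with
`S₄` is `stubDictionary_prod_lift_eq` / `stubDictionary_factorization_S4`
(`Theorems/IneffectiveSubspaceDepthCountedABCStubDictionary.lean`); `S₄(n) > 0` and `n ≤ S₄(n)⁴` are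
`certificates_S4_pos` / `certificates_le_S4_pow_four`
(`Theorems/IneffectiveSubspaceDepthCountedABCCertificatesDictionary.lean`); the `S = ∅` bracket is
`UniformSadicGivesTowerFour.bracket_empty` (`Theorems/IneffectiveSubspaceUniformSadicGivesTowerFour.lean`).
Mathlib only otherwise (`Nat.factorization_le_iff_dvd`, `Finset.prod_mul_distrib`, `Real.rpow_le_rpow`,
`Real.mul_rpow`, `Real.rpow_add`, `Real.rpow_mul`, `Real.rpow_natCast`).  Deliberately NOT here: `LW4`, the dictionary
`LW4 ↔ S4SmallMemberABC`, the deep cells, the power-rich residual and the assembly (the other stubs of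
the line).
-/

-- `Summit.<Summit>.<Problem>` is the mandated summit-side namespace (CONVENTIONS §2); for the
-- single-conjunct summit `ABC` the two coincide, so the duplicate `ABC.ABC` is deliberate.
set_option linter.dupNamespace false

namespace Summit.ABC.ABC.Theorems.DepthCountedABC

open scoped BigOperators

/-! ## Arithmetic of the level-4 radical `S₄(n) = ∏_{p ∣ n} p^⌈v_p(n)/4⌉` -/

/-- `S₄(n) ∣ n` (as `⌈v/4⌉ ≤ v`), hence `S₄(n) ≤ n` for `n ≠ 0`. [folklore] -/
theorem towerFour_S4_le {n : ℕ} (hn : n ≠ 0) :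
    (∏ q ∈ n.primeFactors, q ^ ((n.factorization q + 3) / 4)) ≤ n := by
  refine Nat.le_of_dvd (Nat.pos_of_ne_zero hn) ?_
  rw [← Nat.factorization_le_iff_dvd (certificates_S4_pos n).ne' hn]
  intro p
  rw [stubDictionary_factorization_S4]
  omega

/-! ## The stub -/

/-- **Stub `stub_s4SmallMemberOfTowerFour` of line `Sketch`, crux `DepthCountedABC` (stmt-ABC-14938):
the parent crux #2 `UniformSadicTowerFour` implies `S4SmallMemberABC`** (fully unfolded conclusion):
for every `ε > 0` some `C > 0` gives `c ≤ C · a · (S₄(b)·S₄(c))^(1+ε)` on all abc triples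
(`S₄(n) = ∏_{p ∣ n} p^((v_p(n)+3)/4)`).  Feed the optimal level-4 lifts of `a, b, c` to the tower at
`K = 0`, `S = ∅`, `ε/5`: `c < C · (S₄(a)S₄(b)S₄(c))^(1+ε/5) ≤ C · (a·S)^(1+ε/5)` with `S = S₄(b)S₄(c)`,
and `a^(ε/5) ≤ c^(ε/5) ≤ S^(4ε/5)` since `c ≤ S₄(c)⁴`. [folklore] -/
theorem stub_s4SmallMemberOfTowerFour :
    Summit.ABC.ABC.Theses.IneffectiveSubspace.UniformSadicTowerFour →
    ∀ ε : ℝ, 0 < ε → ∃ C : ℝ, 0 < C ∧ ∀ a b c : ℕ,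
      Literature.NumberTheory.DiophantineGeometry.IsABCTriple a b c →
      (c : ℝ) ≤ C * (a : ℝ) *
        (((∏ p ∈ b.primeFactors, p ^ ((b.factorization p + 3) / 4)) *
          (∏ p ∈ c.primeFactors, p ^ ((c.factorization p + 3) / 4)) : ℕ) : ℝ) ^ (1 + ε) := by
  unfold Summit.ABC.ABC.Theses.IneffectiveSubspace.UniformSadicTowerFour
  intro hT ε hε
  obtain ⟨C, hC, hTow⟩ := hT 0 (ε / 5) (by linarith)
  refine ⟨C, hC, fun a b c habc => ?_⟩
  obtain ⟨ha, hb, hsum, hcop⟩ := habc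
  have hc : 0 < c := by omega
  -- optimal level-4 lifts of `a`, `b`, `c`
  obtain ⟨x, hx0, hxa, hxf⟩ := TowerFourGivesDepthCounted.exists_lift ha.ne'
  obtain ⟨y, hy0, hyb, hyf⟩ := TowerFourGivesDepthCounted.exists_lift hb.ne'
  obtain ⟨z, hz0, hzc, hzf⟩ := TowerFourGivesDepthCounted.exists_lift hc.ne'
  -- the tower at `K = 0`, `S = ∅`, `ε/5`, fed with the lifted point
  have hM0 : (∏ i, x i * y i * z i) ≠ 0 :=
    (Finset.prod_pos fun i _ => Nat.mul_pos (Nat.mul_pos (hx0 i) (hy0 i)) (hz0 i)).ne'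
  have key := hTow ∅ (by simp) (by simp) x y z (fun i => ⟨hx0 i, hy0 i, hz0 i⟩)
    (by rw [hxa, hyb, hzc]; exact hsum) (by rw [hxa, hyb]; exact hcop)
  rw [hzc, UniformSadicGivesTowerFour.bracket_empty hM0] at key
  -- `key : c < C * M^(1+ε/5)`, `M = ∏ x_i y_i z_i = S₄(a) S₄(b) S₄(c)`
  set Sa : ℕ := ∏ q ∈ a.primeFactors, q ^ ((a.factorization q + 3) / 4) with hSa
  set Sb : ℕ := ∏ q ∈ b.primeFactors, q ^ ((b.factorization q + 3) / 4) with hSb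
  set Sc : ℕ := ∏ q ∈ c.primeFactors, q ^ ((c.factorization q + 3) / 4) with hSc
  have hSb0 : 0 < Sb := certificates_S4_pos b
  have hSc0 : 0 < Sc := certificates_S4_pos c
  have hM : (∏ i, x i * y i * z i) = Sa * Sb * Sc := by
    rw [Finset.prod_mul_distrib, Finset.prod_mul_distrib, stubDictionary_prod_lift_eq hx0 hxf,
      stubDictionary_prod_lift_eq hy0 hyf, stubDictionary_prod_lift_eq hz0 hzf]
  rw [hM] at key
  -- `S₄(a) S₄(b) S₄(c) ≤ a · (S₄(b) S₄(c))` and `c ≤ (S₄(b) S₄(c))⁴` in `ℕ`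
  have hMa : Sa * Sb * Sc ≤ a * (Sb * Sc) := by
    rw [mul_assoc]
    exact Nat.mul_le_mul_right _ (towerFour_S4_le ha.ne')
  have hcS : c ≤ (Sb * Sc) ^ 4 := by
    calc c ≤ Sc ^ 4 := certificates_le_S4_pow_four hc.ne'
      _ ≤ (Sb * Sc) ^ 4 := Nat.pow_le_pow_left (Nat.le_mul_of_pos_left Sc hSb0) 4
  -- reals
  set S : ℝ := ((Sb * Sc : ℕ) : ℝ) with hSdef
  have hS1 : (1 : ℝ) ≤ S := by rw [hSdef]; exact_mod_cast mul_pos hSb0 hSc0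
  have hS0 : (0 : ℝ) < S := by linarith
  have haR : (1 : ℝ) ≤ a := by exact_mod_cast ha
  have ha0 : (0 : ℝ) < a := by linarith
  have hcR : (0 : ℝ) < c := by exact_mod_cast hc
  have hMaR : ((Sa * Sb * Sc : ℕ) : ℝ) ≤ (a : ℝ) * S := by
    rw [hSdef]; exact_mod_cast hMa
  have hcSR : (c : ℝ) ≤ S ^ (4 : ℝ) := by
    rw [hSdef, show (4 : ℝ) = (4 : ℕ) by norm_num, Real.rpow_natCast]; exact_mod_cast hcS
  have he : 0 < 1 + ε / 5 := by linarith
  -- `M^(1+ε/5) ≤ (a S)^(1+ε/5) = a · a^(ε/5) · S^(1+ε/5) ≤ a · S^(4ε/5) · S^(1+ε/5) = a · S^(1+ε)`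
  have h1 : ((Sa * Sb * Sc : ℕ) : ℝ) ^ (1 + ε / 5) ≤ ((a : ℝ) * S) ^ (1 + ε / 5) :=
    Real.rpow_le_rpow (Nat.cast_nonneg _) hMaR he.le
  have h2 : ((a : ℝ) * S) ^ (1 + ε / 5) = (a : ℝ) * (a : ℝ) ^ (ε / 5) * S ^ (1 + ε / 5) := by
    rw [Real.mul_rpow ha0.le hS0.le, Real.rpow_add ha0, Real.rpow_one]
  have h3 : (a : ℝ) ^ (ε / 5) ≤ S ^ (4 * (ε / 5)) := by
    have hac : (a : ℝ) ≤ c := by exact_mod_cast (show a ≤ c by omega)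
    calc (a : ℝ) ^ (ε / 5) ≤ (c : ℝ) ^ (ε / 5) := Real.rpow_le_rpow ha0.le hac (by linarith)
      _ ≤ (S ^ (4 : ℝ)) ^ (ε / 5) := Real.rpow_le_rpow hcR.le hcSR (by linarith)
      _ = S ^ (4 * (ε / 5)) := by rw [← Real.rpow_mul hS0.le]
  have h4 : (a : ℝ) * (a : ℝ) ^ (ε / 5) * S ^ (1 + ε / 5) ≤ (a : ℝ) * S ^ (1 + ε) := by
    have hS15 : (0 : ℝ) ≤ S ^ (1 + ε / 5) := (Real.rpow_pos_of_pos hS0 _).le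
    calc (a : ℝ) * (a : ℝ) ^ (ε / 5) * S ^ (1 + ε / 5)
        ≤ (a : ℝ) * S ^ (4 * (ε / 5)) * S ^ (1 + ε / 5) :=
          mul_le_mul_of_nonneg_right (mul_le_mul_of_nonneg_left h3 ha0.le) hS15
      _ = (a : ℝ) * S ^ (1 + ε) := by
          rw [mul_assoc, ← Real.rpow_add hS0]; ring_nf
  calc (c : ℝ) ≤ C * ((Sa * Sb * Sc : ℕ) : ℝ) ^ (1 + ε / 5) := key.le
    _ ≤ C * ((a : ℝ) * S ^ (1 + ε)) := by
        refine mul_le_mul_of_nonneg_left ?_ hC.le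
        exact h1.trans (h2.le.trans h4)
    _ = C * (a : ℝ) * S ^ (1 + ε) := by ring

end Summit.ABC.ABC.Theorems.DepthCountedABC
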